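import Literature.Probability.RandomPlanarGeometry.SLEBubbles
import Literature.Probability.RandomPlanarGeometry.RestrictionConfigEvents
import Literature.Probability.RandomPlanarGeometry.HullApproximation
import HarnessLib

/-!
# `Ξ(κ)` is a random element of `Ω` ([LSW] Thm. 7.3): the measurable version from two leaves, and the countably generated σ-field of `Ω`

Decomposition of the named fact
`Literature.Probability.RandomPlanarGeometry.SLEBubbles.exists_measurable_version` (file
`SLEBubbles`), after

* G. F. Lawler, O. Schramm, W. Werner, *Conformal restriction: the chordal case*, J. Amer. Math.
  Soc. **16** (2003) 917–955, arXiv:math/0209343 (**[LSW]**, arXiv page numbers), Def. 3.1 and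
  §3 p. 10 (the space `Ω` and "the σ-field generated by the events `{K ∈ Ω : K ∩ A = ∅}`,
  where `A ∈ 𝒬*`"), §7.2 and Thm. 7.3 (pp. 28–29: "For any `κ ∈ [0, 8/3]`, the law of `Ξ(κ)` is
  `P_{α_κ}`", eq. (7.3) "`P[Ξ ∩ A = ∅] = Φ'_A(0)^α`", and the end of the proof: "all that remains
  is to show that `cl Ξ = Ξ ∪ {0}`").

The fact says: for `0 < κ ≤ 8/3`, a Brownian bubble measure `μ` and an independent Poisson
cloud of bubbles with mean `λ_κ μ ⊗ dt`, the random set `Ξ(κ)` (`sleBubbleSet`) on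
`((ℝ≥0 → ℝ) × Ω', preWienerMeasure ⊗ P')` has a version which is a MEASURABLE map into `Ω`
(`RestrictionConfig`, avoidance σ-field). It is the conjunction of two statements of a different
nature, which this file separates and proves EQUIVALENT to it
(`SLEBubbles.exists_measurable_version_iff`):

* `Literature.Probability.RandomPlanarGeometry.SLEBubbles.ae_mem_restrictionConfigs` — NAMED
  FACT, the SAMPLE-PATH content of Thm. 7.3: almost surely `Ξ(κ) ∈ Ω` (Def. 3.1: relatively
  closed in `ℍ`, connected, `cl Ξ ∩ ℝ = {0}`, unbounded, `ℂ ∖ cl Ξ` connected). In [LSW] this is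
  what the statement "the law of `Ξ(κ)` is `P_{α_κ}`" (a measure on `Ω`) presupposes; the proof
  addresses closedness ("`cl Ξ = Ξ ∪ {0}`", p. 29, through (7.3), scaling and the stationarity of
  SLE) and relies on [RS] for "`γ` is a simple curve" (p. 28); connectedness (the bubble
  `g_t⁻¹(K + W_t)` accumulates at the tip `γ(t)`), unboundedness and Def. 3.1 (2) are implicit.
* `Literature.Probability.RandomPlanarGeometry.SLEBubbles.nullMeasurableSet_disjoint` — NAMED
  FACT, the MEASURABILITY content, implicit in (7.3) (whose left-hand side `P[Ξ ∩ A = ∅]`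
  presupposes that `{Ξ ∩ A = ∅}` is an event): for every `A ∈ 𝒬*` the set `{Ξ(κ) ∩ A = ∅}` is
  null-measurable for `preWienerMeasure ⊗ P'`. (Stated as NULL-measurability, which is exactly
  what the version needs and what a proof delivers: on the almost sure set where `γ` is a simple
  curve the event is described by the Loewner maps and the counts of the cloud.)

The assembly `SLEBubbles.exists_measurable_version_of_leaves` is PROVED, through a fact about
`Ω` of independent interest:

* `Literature.Probability.RandomPlanarGeometry.RestrictionConfig.avoid_eq_iUnion_dyadic` — **the
  avoidance σ-field of `Ω` is countably generated**: for `A ∈ 𝒬*`, `{K : K ∩ A = ∅}` is the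
  (countable) union of the events `{K : K ∩ D = ∅}` over the `*`-hulls `D ⊇ A` of the form
  `D = hpFill S`, `S` a finite union of closed dyadic squares (`RestrictionConfigEvents`,
  `HalfPlaneFill`): if `K ∈ Ω` misses the compact `A ∌ 0` then `A` is at positive distance from
  `cl K = K ∪ {0}`, the dyadic squares of a fine generation meeting `A` form a set `S ⊇ A` attached
  to the lower half-plane (`A ∪ {Im ≤ 0}` is connected for `A ∈ 𝒬`,
  `IsBoundedHull.isConnected_union_im_nonpos`) and off `cl K`, and `K ∪ (B(0, ρ) ∩ ℍ)`, connected
  and unbounded off `S`, lies in the unbounded component of `ℍ ∖ S`, so that `hpFill S` is a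
  `*`-hull avoided by `K` (`RestrictionConfig.exists_dyadicUnion_isStarHull_hpFill_of_isBoundedHull`,
  the argument of `RestrictionConfig.exists_dyadicUnion_isStarHull_hpFill` with a hull in place of
  a disc). Hence a map into `Ω` is measurable as soon as the countably many dyadic avoidance
  events pull back to measurable sets (`RestrictionConfig.measurable_of_measurableSet_preimage_avoid_hpFill`),
  and a random set which is a.s. in `Ω` and whose dyadic avoidance sets are null-measurable has a
  measurable `Ω`-valued version (`RestrictionConfig.exists_measurable_version_of_nullMeasurableSet`:
  modify it to a fixed configuration off a measurable set of full measure on which each of the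
  countably many events agrees with a measurable one).

Consequently [LSW] Thm. 7.3 in law form (`SLEBubbles.isRestrictionMeasure_map`) holds given the
three leaves `ae_mem_restrictionConfigs`, `nullMeasurableSet_disjoint`, `measure_disjoint`
(`SLEBubbles.isRestrictionMeasure_map_of_leaves`).

Mathlib: `MeasureTheory.NullMeasurableSet.exists_measurable_superset_ae_eq`,
`MeasureTheory.exists_measurable_superset_of_null`, `MeasureTheory.ae_all_iff`,
`measurable_generateFrom`, `IsCompact.exists_cthickening_subset_open`, `isPreconnected_of_forall`.
-/

noncomputable section

open Set Filter Topology MeasureTheory Metric Bornology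
open UpperHalfPlane (upperHalfPlaneSet)
open scoped NNReal ENNReal
open Literature.Probability.Process (preWienerMeasure IsPoissonCloud)

namespace Literature.Probability.RandomPlanarGeometry

/-! ### The avoidance σ-field of `Ω` is countably generated -/

namespace RestrictionConfig

/-- **A bounded hull off `cl K` is swallowed by a `*`-hull avoided by `K`, the fill of a finite
union of dyadic squares.** For `K ∈ Ω` and `A ∈ 𝒬` disjoint from `cl K`: the dyadic squares of
a fine generation meeting the compact set `A` form a compact set `S ⊇ A` still disjoint from
`cl K ∋ 0` and attached to the lower half-plane (`A ∪ {Im ≤ 0}` is connected); its fill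
`hpFill S` is a `*`-hull (`K ∪ (B(0, ρ) ∩ ℍ)` is connected, unbounded and misses `S`, so it lies
in the unbounded component of `ℍ ∖ S`, which therefore reaches `0`) avoided by `K`. (The
argument of `exists_dyadicUnion_isStarHull_hpFill`, with a hull in place of a disc joined to
`−i`.) [folklore] -/
theorem exists_dyadicUnion_isStarHull_hpFill_of_isBoundedHull (K : RestrictionConfig) {A : Set ℂ}
    (hA : IsBoundedHull A) (hdisj : Disjoint A (closure (K : Set ℂ))) :
    ∃ (n : ℕ) (F : Finset (ℤ × ℤ)), A ⊆ dyadicUnion n F ∧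
      IsStarHull (hpFill (dyadicUnion n F)) ∧ Disjoint (K : Set ℂ) (hpFill (dyadicUnion n F)) := by
  -- the open set `U = ℂ ∖ cl K` contains the compact set `A`
  set U : Set ℂ := (closure (K : Set ℂ))ᶜ with hU
  have hUo : IsOpen U := isClosed_closure.isOpen_compl
  have hAU : A ⊆ U := fun z hz hz' ↦ Set.disjoint_left.1 hdisj hz hz'
  have hAc : IsCompact A := hA.isCompact
  -- a fine generation `n`: squares meeting `A` stay inside `U`
  obtain ⟨δ, hδ, hδU⟩ := hAc.exists_cthickening_subset_open hUo hAU
  obtain ⟨n, hn⟩ : ∃ n : ℕ, (2 : ℝ) / 2 ^ n ≤ δ := by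
    obtain ⟨n, hn⟩ := exists_nat_gt (2 / δ)
    refine ⟨n, ?_⟩
    have h2n : (n : ℝ) < 2 ^ n := by exact_mod_cast Nat.lt_two_pow_self
    have h2 : (0 : ℝ) < 2 ^ n := by positivity
    rw [div_le_iff₀ h2]
    rw [div_lt_iff₀ hδ] at hn
    nlinarith
  -- the squares meeting `A`
  set F : Finset (ℤ × ℤ) := (finite_setOf_dyadicSquare_inter_nonempty hA.1 n).toFinset with hF
  have hmemF : ∀ p : ℤ × ℤ, p ∈ F ↔ (dyadicSquare n p.1 p.2 ∩ A).Nonempty := fun p ↦ by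
    rw [hF, Set.Finite.mem_toFinset]
    rfl
  set S : Set ℂ := dyadicUnion n F with hS
  -- `A ⊆ S ⊆ U`
  have hAS : A ⊆ S := fun w hw ↦ by
    rw [hS, mem_dyadicUnion_iff]
    exact ⟨⟨_, _⟩, (hmemF _).2 ⟨w, mem_dyadicSquare_floor w n, hw⟩, mem_dyadicSquare_floor w n⟩
  have hSU : S ⊆ U := fun w hw ↦ by
    rw [hS, mem_dyadicUnion_iff] at hw
    obtain ⟨p, hp, hwp⟩ := hw
    obtain ⟨c, hcp, hcA⟩ := (hmemF p).1 hp
    exact hδU (mem_cthickening_of_dist_le w c δ A hcA ((dist_le_of_mem_dyadicSquare hwp hcp).trans hn))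
  have hKS : Disjoint (K : Set ℂ) S :=
    Set.disjoint_left.2 fun w hwK hwS ↦ hSU hwS (subset_closure hwK)
  have h0S : (0 : ℂ) ∉ S := fun h ↦ hSU h K.zero_mem_closure
  have hSclosed : IsClosed S := isClosed_dyadicUnion
  have hSb : IsBounded S := isBounded_dyadicUnion
  -- `S ∪ {Im ≤ 0}` is connected: every square meets the connected set `A ∪ {Im ≤ 0} ∋ 0`
  have hconn : IsConnected (S ∪ {w : ℂ | w.im ≤ 0}) := by
    have hD : IsPreconnected (A ∪ {w : ℂ | w.im ≤ 0}) :=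
      hA.isConnected_union_im_nonpos.isPreconnected
    have hDsub : A ∪ {w : ℂ | w.im ≤ 0} ⊆ S ∪ {w : ℂ | w.im ≤ 0} := union_subset_union_left _ hAS
    have h0L : (0 : ℂ) ∈ {w : ℂ | w.im ≤ 0} := by simp
    refine ⟨⟨0, Or.inr h0L⟩, isPreconnected_of_forall 0 ?_⟩
    rintro y (hy | hy)
    · rw [hS, mem_dyadicUnion_iff] at hy
      obtain ⟨p, hp, hyp⟩ := hy
      obtain ⟨c, hcp, hcA⟩ := (hmemF p).1 hp
      refine ⟨dyadicSquare n p.1 p.2 ∪ (A ∪ {w : ℂ | w.im ≤ 0}), ?_, Or.inr (Or.inr h0L),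
        Or.inl hyp, ?_⟩
      · refine union_subset (fun w hw ↦ Or.inl ?_) hDsub
        rw [hS, mem_dyadicUnion_iff]
        exact ⟨p, hp, hw⟩
      · exact IsPreconnected.union c hcp (Or.inl hcA) convex_dyadicSquare.isPreconnected hD
    · exact ⟨A ∪ {w : ℂ | w.im ≤ 0}, hDsub, Or.inr h0L, Or.inr hy, hD⟩
  -- `K` lies in the unbounded component `V` of `ℍ ∖ S`, and so does `B(0, ρ) ∩ ℍ` for small `ρ`
  set V : Set ℂ := Loewner.unboundedComponent (upperHalfPlaneSet \ S) with hV
  obtain ⟨ρ, hρ, hρS⟩ : ∃ ρ > 0, ball (0 : ℂ) ρ ⊆ Sᶜ :=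
    Metric.isOpen_iff.1 hSclosed.isOpen_compl 0 h0S
  set W : Set ℂ := ball (0 : ℂ) ρ ∩ upperHalfPlaneSet with hW
  obtain ⟨k, hkK, hkρ⟩ : ((K : Set ℂ) ∩ ball 0 ρ).Nonempty := by
    have := K.zero_mem_closure
    rw [_root_.mem_closure_iff] at this
    obtain ⟨k, hk1, hk2⟩ := this (ball 0 ρ) isOpen_ball (mem_ball_self hρ)
    exact ⟨k, hk2, hk1⟩
  have hTV : W ∪ (K : Set ℂ) ⊆ V := by
    refine subset_unboundedComponent_of_isPreconnected ?_ ?_ ?_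
    · refine IsPreconnected.union k ⟨hkρ, K.subset_upperHalfPlaneSet hkK⟩ hkK ?_
        K.isConnected.isPreconnected
      exact ((convex_ball (0 : ℂ) ρ).inter (convex_halfSpace_im_gt 0)).isPreconnected
    · rintro w (⟨hwρ, hwH⟩ | hwK)
      · exact ⟨hwH, fun hwS ↦ hρS hwρ hwS⟩
      · exact ⟨K.subset_upperHalfPlaneSet hwK, Set.disjoint_left.1 hKS hwK⟩
    · exact fun hb ↦ K.not_isBounded (hb.subset subset_union_right)
  -- hence `0 ∉ hpFill S = cl (ℍ ∖ V)`
  have h0 : (0 : ℂ) ∉ hpFill S := by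
    intro h0
    change (0 : ℂ) ∈ closure (upperHalfPlaneSet \ V) at h0
    rw [_root_.mem_closure_iff] at h0
    obtain ⟨u, huρ, huH, huV⟩ := h0 (ball 0 ρ) isOpen_ball (mem_ball_self hρ)
    exact huV (hTV (Or.inl ⟨huρ, huH⟩))
  refine ⟨n, F, hAS,
    isStarHull_hpFill isSimplyConnected_of_isConnected_compl_holds hSclosed hSb hconn h0, ?_⟩
  -- and `K ⊆ V` misses `hpFill S`
  refine Set.disjoint_left.2 fun w hwK hwF ↦ ?_
  have : w ∈ hpFill S ∩ upperHalfPlaneSet := ⟨hwF, K.subset_upperHalfPlaneSet hwK⟩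
  rw [hpFill_inter hSclosed hSb] at this
  exact this.2 (hTV (Or.inr hwK))

/-- **The avoidance event of a `*`-hull is a countable union of dyadic avoidance events**:
for `A ∈ 𝒬*`, `{K ∈ Ω : K ∩ A = ∅} = ⋃ {K : K ∩ hpFill S = ∅}` over the finite unions `S ⊇ A`
of closed dyadic squares whose fill is a `*`-hull. (`⊇`: `A ∩ ℍ ⊆ S ∩ ℍ ⊆ hpFill S` and
`K ⊆ ℍ`; `⊆`: `exists_dyadicUnion_isStarHull_hpFill_of_isBoundedHull`, `A` being compact, off
`0`, hence off `cl K = K ∪ {0}`.) In particular the σ-field of [LSW] §3 p. 10 on `Ω` is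
generated by countably many of its generators.
[cite: LawlerSchrammWerner2003Restriction, §3 p. 10 (the σ-field on Ω)] -/
theorem avoid_eq_iUnion_dyadic {A : Set ℂ} (hA : IsStarHull A) :
    avoid A = ⋃ (n : ℕ) (F : Finset (ℤ × ℤ))
      (_ : A ⊆ dyadicUnion n F ∧ IsStarHull (hpFill (dyadicUnion n F))),
        avoid (hpFill (dyadicUnion n F)) := by
  ext K
  simp only [mem_iUnion, mem_avoid]
  constructor
  · intro hK
    have hdisj : Disjoint A (closure (K : Set ℂ)) := by
      refine Set.disjoint_left.2 fun z hzA hzcl ↦ ?_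
      rcases K.closure_subset hzcl with hzK | hz0
      · exact Set.disjoint_left.1 hK hzK hzA
      · rw [mem_singleton_iff] at hz0
        exact hA.zero_notMem (hz0 ▸ hzA)
    obtain ⟨n, F, hsub, hstar, hd⟩ :=
      K.exists_dyadicUnion_isStarHull_hpFill_of_isBoundedHull hA.isBoundedHull hdisj
    exact ⟨n, F, ⟨hsub, hstar⟩, hd⟩
  · rintro ⟨n, F, ⟨hsub, -⟩, hK⟩
    refine Set.disjoint_left.2 fun z hzK hzA ↦ Set.disjoint_left.1 hK hzK ?_
    exact inter_subset_hpFill _ ⟨hsub hzA, K.subset_upperHalfPlaneSet hzK⟩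

/-- **Measurability into `Ω` is tested on countably many dyadic `*`-hulls**: a map `f` into `Ω`
is measurable for the avoidance σ-field as soon as `f⁻¹{K : K ∩ hpFill S = ∅}` is measurable
for every finite union `S` of closed dyadic squares whose fill is a `*`-hull
(`avoid_eq_iUnion_dyadic`). [folklore] -/
theorem measurable_of_measurableSet_preimage_avoid_hpFill {α : Type*} [MeasurableSpace α]
    {f : α → RestrictionConfig}
    (h : ∀ (n : ℕ) (F : Finset (ℤ × ℤ)), IsStarHull (hpFill (dyadicUnion n F)) →
      MeasurableSet (f ⁻¹' avoid (hpFill (dyadicUnion n F)))) :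
    Measurable f := by
  refine measurable_generateFrom ?_
  rintro _ ⟨A, hA, rfl⟩
  rw [avoid_eq_iUnion_dyadic hA]
  simp only [preimage_iUnion]
  exact MeasurableSet.iUnion fun n ↦ MeasurableSet.iUnion fun F ↦
    MeasurableSet.iUnion fun hF ↦ h n F hF.2

/-- **A random set almost surely in `Ω` with null-measurable dyadic avoidance sets has a
measurable `Ω`-valued version.** If `Ξ : α → Set ℂ` satisfies `Ξ ∈ Ω` a.e. and, for each of the
countably many dyadic `*`-hulls `D = hpFill S`, the set `{Ξ ∩ D = ∅}` is null-measurable, then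
some measurable `Kc : α → Ω` agrees with `Ξ` almost everywhere: choose measurable events
`E_D =ᵐ {Ξ ∩ D = ∅}`, a measurable set `G` of full measure on which `Ξ ∈ Ω` and all these
agreements hold pointwise, and put `Kc = Ξ` on `G` and a fixed configuration off `G`; then
`Kc⁻¹{K ∩ D = ∅} = (G ∩ E_D) ∪ (Gᶜ ∩ const)` (`measurable_of_measurableSet_preimage_avoid_hpFill`).
[folklore] -/
theorem exists_measurable_version_of_nullMeasurableSet {α : Type*} [MeasurableSpace α]
    {P : Measure α} {Ξ : α → Set ℂ} (h1 : ∀ᵐ a ∂P, Ξ a ∈ restrictionConfigs)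
    (h2 : ∀ (n : ℕ) (F : Finset (ℤ × ℤ)), IsStarHull (hpFill (dyadicUnion n F)) →
      NullMeasurableSet {a | Disjoint (Ξ a) (hpFill (dyadicUnion n F))} P) :
    ∃ Kc : α → RestrictionConfig, Measurable Kc ∧ ∀ᵐ a ∂P, (Kc a : Set ℂ) = Ξ a := by
  classical
  -- measurable events a.e. equal to the countably many dyadic avoidance sets
  have hE : ∀ (n : ℕ) (F : Finset (ℤ × ℤ)), ∃ E : Set α, MeasurableSet E ∧
      (IsStarHull (hpFill (dyadicUnion n F)) →
        ∀ᵐ a ∂P, a ∈ E ↔ Disjoint (Ξ a) (hpFill (dyadicUnion n F))) := by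
    intro n F
    by_cases h : IsStarHull (hpFill (dyadicUnion n F))
    · obtain ⟨E, -, hEm, hEeq⟩ := (h2 n F h).exists_measurable_superset_ae_eq
      exact ⟨E, hEm, fun _ ↦ Filter.eventuallyEq_set.1 hEeq⟩
    · exact ⟨∅, MeasurableSet.empty, fun h' ↦ absurd h' h⟩
  choose E hEm hEeq using hE
  -- the good samples: `Ξ ∈ Ω` and all the agreements
  have hgood : ∀ᵐ a ∂P, Ξ a ∈ restrictionConfigs ∧ ∀ (n : ℕ) (F : Finset (ℤ × ℤ)),
      IsStarHull (hpFill (dyadicUnion n F)) →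
        (a ∈ E n F ↔ Disjoint (Ξ a) (hpFill (dyadicUnion n F))) := by
    refine h1.and (ae_all_iff.2 fun n ↦ ae_all_iff.2 fun F ↦ ?_)
    by_cases h : IsStarHull (hpFill (dyadicUnion n F))
    · filter_upwards [hEeq n F h] with a ha using fun _ ↦ ha
    · exact ae_of_all _ fun a h' ↦ absurd h' h
  rw [ae_iff] at hgood
  obtain ⟨N, hNsub, hNm, hN0⟩ := exists_measurable_superset_of_null hgood
  set G : Set α := Nᶜ with hGdef
  have hGm : MeasurableSet G := hNm.compl
  have hG : ∀ a ∈ G, Ξ a ∈ restrictionConfigs ∧ ∀ (n : ℕ) (F : Finset (ℤ × ℤ)),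
      IsStarHull (hpFill (dyadicUnion n F)) →
        (a ∈ E n F ↔ Disjoint (Ξ a) (hpFill (dyadicUnion n F))) := fun a ha ↦ by
    by_contra hcon
    exact ha (hNsub hcon)
  have hGae : ∀ᵐ a ∂P, a ∈ G := by
    rw [ae_iff]
    have : {a : α | ¬a ∈ G} = N := by
      ext a
      simp [hGdef]
    rw [this]
    exact hN0
  -- the version
  let Kc : α → RestrictionConfig := fun a ↦
    if ha : a ∈ G then ⟨Ξ a, (hG a ha).1⟩ else imaginaryAxis
  refine ⟨Kc, ?_, ?_⟩
  · refine measurable_of_measurableSet_preimage_avoid_hpFill fun n F hF ↦ ?_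
    have hrep : Kc ⁻¹' avoid (hpFill (dyadicUnion n F)) =
        (G ∩ E n F) ∪ (Gᶜ ∩ {_a | Disjoint ((imaginaryAxis : RestrictionConfig) : Set ℂ)
          (hpFill (dyadicUnion n F))}) := by
      ext a
      simp only [mem_preimage, mem_avoid, mem_union, mem_inter_iff, mem_setOf_eq, mem_compl_iff]
      by_cases ha : a ∈ G
      · simp only [Kc, ha, dif_pos, true_and, not_true_eq_false, false_and, or_false]
        show Disjoint (Ξ a) (hpFill (dyadicUnion n F)) ↔ a ∈ E n F
        exact ((hG a ha).2 n F hF).symm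
      · simp only [Kc, ha, dif_neg, not_false_eq_true, false_and, true_and, false_or]
    rw [hrep]
    exact (hGm.inter (hEm n F)).union (hGm.compl.inter (MeasurableSet.const _))
  · filter_upwards [hGae] with a ha
    simp only [Kc, ha, dif_pos]

end RestrictionConfig

/-! ### The two leaves of `SLEBubbles.exists_measurable_version` -/

/-- NAMED FACT — **`Ξ(κ) ∈ Ω` almost surely** ([LSW] Thm. 7.3, p. 29: "For any `κ ∈ [0, 8/3]`,
the law of `Ξ(κ)` is `P_{α_κ}`" — a probability measure on the space `Ω` of Def. 3.1, so that
the statement presupposes `Ξ(κ) ∈ Ω` a.s.; end of the proof, p. 29: "all that remains is to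
show that `cl Ξ = Ξ ∪ {0}`", proved there from (7.3), scaling and the stationarity of SLE; and
p. 28: "Since `κ ≤ 8/3`, we know from [RS] that `γ` is a simple curve"): for `0 < κ ≤ 8/3`, a
Brownian bubble measure `μ`, and an independent Poisson cloud `X` with mean `λ_κ μ ⊗ dt` on a
probability space `(Ω', P')`, for `preWienerMeasure ⊗ P'`-almost every `(ω, ω')` the set
`Ξ(κ) = F^ℝ_ℍ(γ(0, ∞) ∪ ⋃_{(K,t) ∈ X(ω')} g_t⁻¹(K + W_t))` (`sleBubbleSet κ ω (X ω')`) belongs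
to `Ω` (`restrictionConfigs`): relatively closed in `ℍ`, connected, `cl Ξ ∩ ℝ = {0}`,
unbounded, `ℂ ∖ cl Ξ` connected. Ingredients beyond the printed closedness argument: the
SLE_κ trace is a simple curve in `ℍ ∪ {0}` (Rohde–Schramm; the tree's
`ae_isSimpleTrace_sleTrace_of_le_four`), each bubble `g_t⁻¹(K + W_t)` accumulates exactly at
the tip `γ(t)` (`Loewner.IsGeneratedByCurve.tendsto_invFunOn_map`), and Def. 3.1 (2) for `Ξ`
(implicit in [LSW]). The sample-path half of `SLEBubbles.exists_measurable_version`, which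
implies it (`SLEBubbles.ae_mem_restrictionConfigs_of`).
[cite: LawlerSchrammWerner2003Restriction, Thm. 7.3 and end of its proof (p. 29), with Def. 3.1 (p. 10)] -/
def SLEBubbles.ae_mem_restrictionConfigs : Prop :=
  ∀ {κ : ℝ≥0}, 0 < κ → κ ≤ 8 / 3 → ∀ {μ : Measure BubbleConfig}, IsBrownianBubbleMeasure μ →
    ∀ {Ω' : Type} [MeasurableSpace Ω'] {P' : Measure Ω'} {X : Ω' → Set (BubbleConfig × ℝ≥0)},
      IsPoissonCloud (bubbleCloudIntensity κ μ) X P' →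
        ∀ᵐ p ∂(preWienerMeasure.prod P'), sleBubbleSet κ p.1 (X p.2) ∈ restrictionConfigs

/-- NAMED FACT — **the avoidance sets of `Ξ(κ)` are events** ([LSW] Thm. 7.3 with eq. (7.3),
p. 29: "`P[Ξ ∩ A = ∅] = Φ'_A(0)^α`" for `A ∈ 𝒬*`, whose left-hand side presupposes that
`{Ξ ∩ A = ∅}` is an event of the product of the Wiener space and the space of the Poisson cloud;
[LSW] do not discuss measurability): for `0 < κ ≤ 8/3`, a Brownian bubble measure `μ`, an
independent Poisson cloud `X` with mean `λ_κ μ ⊗ dt` on `(Ω', P')`, and every `A ∈ 𝒬*`, the set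
`{(ω, ω') : Ξ(κ) ∩ A = ∅}` is NULL-measurable for `preWienerMeasure ⊗ P'` (on the almost sure
set where `γ` is a simple curve avoiding `A` it is the event that no point `(K, t)` of the cloud
has `K ∩ (g_t(A) − W_t) ≠ ∅`, `g_t(A) − W_t ∈ 𝒬*`, cf. the display before (7.3)). The
measurability half of `SLEBubbles.exists_measurable_version`, which implies it
(`SLEBubbles.nullMeasurableSet_disjoint_of`).
[cite: LawlerSchrammWerner2003Restriction, Thm. 7.3 with eq. (7.3) (p. 29)] -/
def SLEBubbles.nullMeasurableSet_disjoint : Prop :=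
  ∀ {κ : ℝ≥0}, 0 < κ → κ ≤ 8 / 3 → ∀ {μ : Measure BubbleConfig}, IsBrownianBubbleMeasure μ →
    ∀ {Ω' : Type} [MeasurableSpace Ω'] {P' : Measure Ω'} {X : Ω' → Set (BubbleConfig × ℝ≥0)},
      IsPoissonCloud (bubbleCloudIntensity κ μ) X P' →
        ∀ {A : Set ℂ}, IsStarHull A →
          NullMeasurableSet {p : (ℝ≥0 → ℝ) × Ω' | Disjoint (sleBubbleSet κ p.1 (X p.2)) A}
            (preWienerMeasure.prod P')

/-! ### The leaves are necessary -/

/-- **The target implies the sample-path leaf**: a measurable `Ω`-valued version of `Ξ(κ)`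
shows `Ξ(κ) ∈ Ω` almost surely. [cite: LawlerSchrammWerner2003Restriction, Thm. 7.3 (p. 29)] -/
theorem SLEBubbles.ae_mem_restrictionConfigs_of (h : SLEBubbles.exists_measurable_version) :
    SLEBubbles.ae_mem_restrictionConfigs := by
  intro κ hκ0 hκ μ hμ Ω' _ P' X hX
  obtain ⟨Kc, -, hae⟩ := h hκ0 hκ hμ hX
  filter_upwards [hae] with p hp
  rw [← hp]
  exact (Kc p).2

/-- **The target implies the measurability leaf**: the avoidance set `{Ξ(κ) ∩ A = ∅}` is a.e.
equal to the preimage of the event `{K ∩ A = ∅}` under a measurable version.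
[cite: LawlerSchrammWerner2003Restriction, Thm. 7.3 with eq. (7.3) (p. 29)] -/
theorem SLEBubbles.nullMeasurableSet_disjoint_of (h : SLEBubbles.exists_measurable_version) :
    SLEBubbles.nullMeasurableSet_disjoint := by
  intro κ hκ0 hκ μ hμ Ω' _ P' X hX A hA
  obtain ⟨Kc, hKc, hae⟩ := h hκ0 hκ hμ hX
  have hmeas : MeasurableSet (Kc ⁻¹' RestrictionConfig.avoid A) :=
    hKc (RestrictionConfig.measurableSet_avoid hA)
  exact hmeas.nullMeasurableSet.congr (SLEBubbles.preimage_avoid_ae_eq hae A)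

/-! ### The assembly -/

/-- **`Ξ(κ)` has a measurable `Ω`-valued version, from the two leaves**: the named fact
`SLEBubbles.exists_measurable_version` ([LSW] Thm. 7.3: `Ξ(κ)` is a random element of `Ω`)
follows from `Ξ(κ) ∈ Ω` a.s. (`SLEBubbles.ae_mem_restrictionConfigs`) and the null-measurability
of its avoidance sets (`SLEBubbles.nullMeasurableSet_disjoint`), by
`RestrictionConfig.exists_measurable_version_of_nullMeasurableSet` (the avoidance σ-field of `Ω`
being countably generated, `RestrictionConfig.avoid_eq_iUnion_dyadic`).
[cite: LawlerSchrammWerner2003Restriction, Thm. 7.3 (p. 29) with §3 p. 10] -/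
theorem SLEBubbles.exists_measurable_version_of_leaves (h₁ : SLEBubbles.ae_mem_restrictionConfigs)
    (h₂ : SLEBubbles.nullMeasurableSet_disjoint) : SLEBubbles.exists_measurable_version := by
  intro κ hκ0 hκ μ hμ Ω' _ P' X hX
  exact RestrictionConfig.exists_measurable_version_of_nullMeasurableSet (h₁ hκ0 hκ hμ hX)
    fun n F hF ↦ h₂ hκ0 hκ hμ hX hF

/-- **The decomposition is exact**: `SLEBubbles.exists_measurable_version` is equivalent to the
conjunction of its sample-path leaf and its measurability leaf.
[cite: LawlerSchrammWerner2003Restriction, Thm. 7.3 (p. 29)] -/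
theorem SLEBubbles.exists_measurable_version_iff :
    SLEBubbles.exists_measurable_version ↔
      SLEBubbles.ae_mem_restrictionConfigs ∧ SLEBubbles.nullMeasurableSet_disjoint :=
  ⟨fun h ↦ ⟨SLEBubbles.ae_mem_restrictionConfigs_of h, SLEBubbles.nullMeasurableSet_disjoint_of h⟩,
    fun h ↦ SLEBubbles.exists_measurable_version_of_leaves h.1 h.2⟩

/-- **[LSW] Theorem 7.3 in law form from three leaves**: given `Ξ(κ) ∈ Ω` a.s., the
null-measurability of its avoidance sets, and the avoidance formula (7.3)
(`SLEBubbles.measure_disjoint`), the law of the measurable version of `Ξ(κ)` is the restriction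
measure `P_{α_κ}` (`SLEBubbles.isRestrictionMeasure_map`).
[cite: LawlerSchrammWerner2003Restriction, Thm. 7.3 (p. 29)] -/
theorem SLEBubbles.isRestrictionMeasure_map_of_leaves (h₁ : SLEBubbles.ae_mem_restrictionConfigs)
    (h₂ : SLEBubbles.nullMeasurableSet_disjoint) (h₃ : SLEBubbles.measure_disjoint)
    {κ : ℝ≥0} (hκ0 : 0 < κ) (hκ : κ ≤ 8 / 3) {μ : Measure BubbleConfig} (hμ : IsBrownianBubbleMeasure μ)
    {Ω' : Type} [MeasurableSpace Ω'] {P' : Measure Ω'} {X : Ω' → Set (BubbleConfig × ℝ≥0)}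
    (hX : IsPoissonCloud (bubbleCloudIntensity κ μ) X P') :
    ∃ Kc : (ℝ≥0 → ℝ) × Ω' → RestrictionConfig, Measurable Kc ∧
      (∀ᵐ p ∂(preWienerMeasure.prod P'), (Kc p : Set ℂ) = sleBubbleSet κ p.1 (X p.2)) ∧
        IsRestrictionMeasure (sleBubbleExponent κ) ((preWienerMeasure.prod P').map Kc) :=
  SLEBubbles.isRestrictionMeasure_map (SLEBubbles.exists_measurable_version_of_leaves h₁ h₂) h₃
    hκ0 hκ hμ hX

end Literature.Probability.RandomPlanarGeometry

end
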